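import Literature.NumberTheory.GaloisRepresentations.TateLevelOneWildOdd
import Literature.NumberTheory.GaloisRepresentations.TateLocalH2Vanishing
import Literature.NumberTheory.GaloisRepresentations.TateH2VanishingGlobalAssembly
import Literature.NumberTheory.Automorphic.AdicCompletionResidueCard
import HarnessLib

/-!
# Tate's theorem `H²(G_ℚ, ℚ/ℤ) = 0` at level one, III: the local theorem in generator form
# (`H²(Γ_F, ℤ/p) = δ(ℤ · ψ)` for a tame character `ψ` of exact order `p^a ∥ q - 1` on inertia)

Sibling proof file (theorems only) of `TateProjectiveLifting.lean`; continuation of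
`TateLevelOneLocalCharacters.lean` and `TateLevelOneWildOdd.lean` (Serre, Durham 1977, §6.5 run
over `ℚ`).  Serre §6.5 (b): for a non-archimedean local field `K` (containing `μ_p`),
`Br_p(K) = ℤ/p` and `δ : H¹(K, ℚ_p/ℤ_p) → H²(K, ℤ/p)` is onto, `δ(χ) = 0` iff `χ` is a `p`-th
power iff `χ` is trivial on `μ_p ⊂ K^×`.  In the cochain language of the tree (a class of
`H²(Γ_F, ℤ/p)` "is `δ(λ)`" when a representing `p`-torsion cocycle `g` is `∂β` with `p β = λ`),
and on the Galois side, this file proves the corresponding **generator form of Tate's local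
theorem at level one** for a local field `F` of residue characteristic `≠ p`:

* `tame_character_eq_zsmul_add_nsmul` — if `ψ` is a locally constant character with
  `p^a ψ = 0` on `I_F` and `ψ(σ₀) = 1/p^a` for some `σ₀ ∈ I_F`, where `p^a ∥ q - 1`, then every
  locally constant character `λ` of `p`-power order is `j • ψ + p • λ'` (`j ∈ ℤ`, `λ'` locally
  constant): the tame relation `(q-1) λ = 0` on `I_F`, tame cyclicity, and the divisibility of
  unramified characters (`TateLevelOneLocalCharacters.lean`);
* `twoCocycle_prime_split_generator_form` — hence (with Tate's local theorem
  `twoCocycle_addCircle_prime_split_localField`, `char F = 0`) **every locally constant `p`-torsion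
  `2`-cocycle `g` on `Γ_F` is `∂β` with `β` locally constant and `p β = j • ψ`**; in particular
  (`twoCocycle_prime_split_levelOne_of_not_dvd`) if `p ∤ q - 1` then `g = ∂β` with `p β = 0`, i.e.
  `H²(Γ_F, ℤ/p) = 0` at level one ("`α_v = 0`" at such places);
* `adicCompletion_rat_twoCocycle_prime_split_cyclotomic` — for `F = ℚ_ℓ`, `ℓ ≠ p`, the character
  `ψ = s ∘ χ_ℓ` (`χ_ℓ` the mod `ℓ` cyclotomic character, `s` a character of `(ℤ/ℓ)ˣ` of exact order
  `p^a ∥ ℓ - 1`, `exists_character_units_zmod_of_dvd`) qualifies (`χ_ℓ(I_{ℚ_ℓ}) = (ℤ/ℓ)ˣ`: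
  `ℚ_ℓ(μ_ℓ)/ℚ_ℓ` is totally ramified), so every `p`-torsion class of `H²(ℚ_ℓ, ℤ/p)` is
  `δ(j · s ∘ χ_ℓ)` — the local components at `ℓ` are accounted for by (restrictions of) Dirichlet
  characters of conductor `ℓ`.

## References

* J.-P. Serre, *Modular forms of weight one and Galois representations* (Durham 1977), §6.5 (b).
  [SerreDurham1977]
* J.-P. Serre, *Local Fields*, GTM 67 (1979), Ch. IV §2, §4 Prop. 16–17. [SerreLocalFields1979]
-/

noncomputable section

open Field ValuativeRel IsDedekindDomain
open scoped Pointwise Valued NumberField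

namespace Literature.NumberTheory.GaloisRepresentations

open GaloisRepresentations.IsNonarchimedeanLocalField

universe u

/-! ### Torsion bookkeeping -/

section Aux

variable {A : Type*} [AddCommGroup A]

/-- If `m • x = 0` and `n • x = 0` then `gcd(m, n) • x = 0` (Bézout). [folklore] -/
theorem gcd_nsmul_eq_zero {m n : ℕ} {x : A} (hm : m • x = 0) (hn : n • x = 0) :
    (Nat.gcd m n) • x = 0 := by
  rw [← natCast_zsmul, Nat.gcd_eq_gcd_ab m n, add_zsmul, mul_comm (m : ℤ), mul_comm (n : ℤ),
    mul_zsmul, mul_zsmul, natCast_zsmul, natCast_zsmul, hm, hn, zsmul_zero, zsmul_zero, add_zero]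

/-- `1 / p^0 = 1 ↦ 0` in `ℚ/ℤ`. [folklore] -/
theorem addCircle_coe_one_div_pow_zero (p : ℕ) :
    ((((1 : ℚ) / (p ^ 0 : ℕ) : ℚ)) : AddCircle (1 : ℚ)) = 0 := by
  rw [pow_zero, Nat.cast_one, div_one]
  exact AddCircle.coe_period 1

end Aux

/-! ### The local theorem in generator form, `F` of residue characteristic `≠ p` -/

section Local

variable (F : Type u) [Field F] [ValuativeRel F] [TopologicalSpace F] [IsNonarchimedeanLocalField F]

/-- **Characters of `p`-power order modulo `p`-th multiples** (residue characteristic `≠ p`,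
`p^a ∥ q - 1`).  Let `ψ : Γ_F → ℚ/ℤ` be a locally constant character with `p^a • ψ = 0` on `I_F`
and `ψ(σ₀) = 1/p^a` for some `σ₀ ∈ I_F`.  Then every locally constant character `λ` of `p`-power
order is `λ = j • ψ + p • λ'` with `j ∈ ℤ` and `λ'` locally constant.  (On `I_F`,
`(q - 1) λ = 0` up to a power of the residue characteristic
(`tame_nsmul_apply_eq_zero_of_mem_absInertia`), so `p^a λ = 0` there; by tame cyclicity
(`tame_character_eq_zsmul_on_absInertia`) `λ = j ψ` on `I_F`; and `λ - j ψ`, unramified, is a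
`p`-th multiple (`unramified_character_nsmul_divisible`).)  This is Serre's "`φ` is a `p`-th power
iff `φ` is trivial on `μ_p`" (the known structure of `K^×`, §6.5 (b)) on the Galois side.
[cite: SerreDurham1977, §6.5 (b)] [cite: SerreLocalFields1979, Ch. IV §2 Cor. 1 of Prop. 7] -/
theorem tame_character_eq_zsmul_add_nsmul {p : ℕ} (hp : p.Prime) (hpℓ : p ≠ ringChar 𝓀[F])
    {a : ℕ} (hpa' : ¬ p ^ (a + 1) ∣ residueFieldCard F - 1)
    (psi : absoluteGaloisGroup F → AddCircle (1 : ℚ)) (hpsi_lc : IsLocallyConstant psi)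
    (hpsi : ∀ σ τ, psi (σ * τ) = psi σ + psi τ)
    (hpsia : ∀ σ ∈ absInertia F, p ^ a • psi σ = 0)
    (hpsifull : ∃ σ₀ ∈ absInertia F, psi σ₀ = (((1 : ℚ) / (p ^ a : ℕ) : ℚ) : AddCircle (1 : ℚ)))
    (lam : absoluteGaloisGroup F → AddCircle (1 : ℚ)) (hlam_lc : IsLocallyConstant lam)
    (hlam : ∀ σ τ, lam (σ * τ) = lam σ + lam τ) {k : ℕ} (hlamk : ∀ σ, p ^ k • lam σ = 0) :
    ∃ (j : ℤ) (lam' : absoluteGaloisGroup F → AddCircle (1 : ℚ)), IsLocallyConstant lam' ∧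
      (∀ σ τ, lam' (σ * τ) = lam' σ + lam' τ) ∧ ∀ σ, lam σ = j • psi σ + p • lam' σ := by
  have hℓ : (ringChar 𝓀[F]).Prime := ringChar_residueField_prime (F := F)
  -- `p^a • lam = 0` on inertia
  have hlama : ∀ σ ∈ absInertia F, p ^ a • lam σ = 0 := fun σ hσ => by
    obtain ⟨b, hb⟩ := tame_nsmul_apply_eq_zero_of_mem_absInertia F lam hlam_lc hlam hσ
    have hg := gcd_nsmul_eq_zero (hlamk σ) hb
    -- `gcd (p^k) (ℓ'^b (q-1)) ∣ p^a`
    obtain ⟨j, hjk, hj⟩ := (Nat.dvd_prime_pow hp).mp (Nat.gcd_dvd_left (p ^ k)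
      (ringChar 𝓀[F] ^ b * (residueFieldCard F - 1)))
    have hjdvd : p ^ j ∣ residueFieldCard F - 1 := by
      have h1 : p ^ j ∣ ringChar 𝓀[F] ^ b * (residueFieldCard F - 1) := hj ▸ Nat.gcd_dvd_right _ _
      have hcop : Nat.Coprime (p ^ j) (ringChar 𝓀[F] ^ b) :=
        Nat.Coprime.pow _ _ ((Nat.coprime_primes hp hℓ).mpr hpℓ)
      exact hcop.dvd_of_dvd_mul_left h1
    have hja : j ≤ a := by
      by_contra hlt
      exact hpa' ((pow_dvd_pow p (Nat.lt_of_not_le hlt)).trans hjdvd)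
    obtain ⟨d, hd⟩ := pow_dvd_pow p hja
    rw [hd, mul_nsmul, ← hj, hg, nsmul_zero]
  -- tame cyclicity: `lam = j • psi` on inertia
  have hpd : ¬ ringChar 𝓀[F] ∣ p ^ a := fun h =>
    hpℓ ((Nat.prime_dvd_prime_iff_eq hℓ hp).mp (hℓ.dvd_of_dvd_pow h)).symm
  obtain ⟨j, hj⟩ := tame_character_eq_zsmul_on_absInertia F lam psi hlam_lc hlam hpsi_lc hpsi
    (pow_pos hp.pos a) hpd hlama hpsia hpsifull
  -- `ν = lam - j • psi` is unramified, hence a `p`-th multiple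
  set ν : absoluteGaloisGroup F → AddCircle (1 : ℚ) := fun σ => lam σ - j • psi σ with hν_def
  have hν_lc : IsLocallyConstant ν := hlam_lc.comp₂ hpsi_lc fun x y => x - j • y
  have hν_add : ∀ σ τ, ν (σ * τ) = ν σ + ν τ := fun σ τ => by
    simp only [hν_def, hlam, hpsi, zsmul_add]
    abel
  have hνI : ∀ σ ∈ absInertia F, ν σ = 0 := fun σ hσ => by
    simp only [hν_def, hj σ hσ, sub_self]
  obtain ⟨ν', hν'_lc, hν'_add, -, hν'⟩ :=
    unramified_character_nsmul_divisible F ν hν_lc hν_add hνI hp.pos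
  refine ⟨j, ν', hν'_lc, hν'_add, fun σ => ?_⟩
  rw [hν' σ]
  show lam σ = j • psi σ + (lam σ - j • psi σ)
  abel

variable {F} in
/-- If `g = ∂c` with `c` locally constant and `p • g = 0`, then `λ = p • c` is a locally constant
additive character. [folklore] -/
theorem character_nsmul_of_coboundary {G : Type*} [Group G] [TopologicalSpace G] {p : ℕ}
    {g : G → G → AddCircle (1 : ℚ)} (hpg : ∀ σ τ, p • g σ τ = 0) {c : G → AddCircle (1 : ℚ)}
    (hc : ∀ σ τ, g σ τ + c (σ * τ) = c σ + c τ) (σ τ : G) :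
    p • c (σ * τ) = p • c σ + p • c τ := by
  have h := congrArg (fun x => p • x) (hc σ τ)
  simp only [nsmul_add, hpg, zero_add] at h
  exact h

/-- **Tate's local theorem at level one, generator form** (residue characteristic `≠ p`,
`char F = 0`, `p^a ∥ q - 1`, `ψ` as in `tame_character_eq_zsmul_add_nsmul`): every locally
constant `p`-torsion `2`-cocycle `g : Γ_F × Γ_F → ℚ/ℤ` is `∂β` with `β` locally constant and
`p • β = j • ψ` for an integer `j` — i.e. its class in `H²(Γ_F, ℤ/p)` is `δ(j ψ)`.  (Tate's local
theorem gives `g = ∂c`; `λ = p c` is a character of `p`-power order, `= j ψ + p λ'`; take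
`β = c - λ'`.)  Serre §6.5 (b): `Br_p(K) = ℤ/p` is generated by `δ(χ)` for one character `χ`
non-trivial on `μ_p`. [cite: SerreDurham1977, §6.5 (b)] -/
theorem twoCocycle_prime_split_generator_form (F : Type) [Field F] [ValuativeRel F]
    [TopologicalSpace F] [IsNonarchimedeanLocalField F] [CharZero F]
    {p : ℕ} (hp : p.Prime) (hpℓ : p ≠ ringChar 𝓀[F])
    {a : ℕ} (hpa' : ¬ p ^ (a + 1) ∣ residueFieldCard F - 1)
    (psi : absoluteGaloisGroup F → AddCircle (1 : ℚ)) (hpsi_lc : IsLocallyConstant psi)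
    (hpsi : ∀ σ τ, psi (σ * τ) = psi σ + psi τ)
    (hpsia : ∀ σ ∈ absInertia F, p ^ a • psi σ = 0)
    (hpsifull : ∃ σ₀ ∈ absInertia F, psi σ₀ = (((1 : ℚ) / (p ^ a : ℕ) : ℚ) : AddCircle (1 : ℚ)))
    (g : absoluteGaloisGroup F → absoluteGaloisGroup F → AddCircle (1 : ℚ))
    (hg : IsLocallyConstant (Function.uncurry g))
    (hcoc : ∀ σ τ υ, g σ τ + g (σ * τ) υ = g τ υ + g σ (τ * υ)) (hpg : ∀ σ τ, p • g σ τ = 0) :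
    ∃ (β : absoluteGaloisGroup F → AddCircle (1 : ℚ)) (j : ℤ), IsLocallyConstant β ∧
      (∀ σ τ, g σ τ + β (σ * τ) = β σ + β τ) ∧ ∀ σ, p • β σ = j • psi σ := by
  haveI : CompactSpace (absoluteGaloisGroup F) := absoluteGaloisGroup_compactSpace F
  -- Tate's local theorem, and a `p`-power torsion splitting
  obtain ⟨c, hc_lc, hc⟩ := twoCocycle_addCircle_prime_split_localField F hp g hg hcoc hpg
  obtain ⟨k, β₀, hβ₀_lc, hβ₀k, hβ₀⟩ :=
    exists_primePow_torsion_coboundary_of_coboundary hp hpg hc_lc hc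
  -- the character `λ = p • β₀`
  set lam : absoluteGaloisGroup F → AddCircle (1 : ℚ) := fun σ => p • β₀ σ with hlam_def
  have hlam_lc : IsLocallyConstant lam := hβ₀_lc.comp fun x => p • x
  have hlam : ∀ σ τ, lam (σ * τ) = lam σ + lam τ := character_nsmul_of_coboundary hpg hβ₀
  have hlamk : ∀ σ, p ^ k • lam σ = 0 := fun σ => by
    simp only [hlam_def]
    rw [smul_comm, hβ₀k, smul_zero]
  obtain ⟨j, lam', hlam'_lc, hlam'_add, hlam'⟩ := tame_character_eq_zsmul_add_nsmul F hp hpℓ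
    hpa' psi hpsi_lc hpsi hpsia hpsifull lam hlam_lc hlam hlamk
  refine ⟨fun σ => β₀ σ - lam' σ, j, hβ₀_lc.comp₂ hlam'_lc fun x y => x - y, fun σ τ => ?_,
    fun σ => ?_⟩
  · show g σ τ + (β₀ (σ * τ) - lam' (σ * τ)) = (β₀ σ - lam' σ) + (β₀ τ - lam' τ)
    rw [hlam'_add, ← add_sub_assoc, hβ₀]
    abel
  · show p • (β₀ σ - lam' σ) = j • psi σ
    have h1 := hlam' σ
    simp only [hlam_def] at h1
    rw [nsmul_sub, h1]
    abel

/-- **`H²(Γ_F, ℤ/p) = 0` at level one when `p ∤ q - 1`** (residue characteristic `≠ p`,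
`char F = 0`): every locally constant `p`-torsion `2`-cocycle `g` on `Γ_F` is `∂β` with `β`
locally constant and `p • β = 0` (Serre §6.5 (c): "`α_v = 0`" — here because `μ_p ⊄ F` and no
character is non-trivial on `μ_p(F) = 1`). [cite: SerreDurham1977, §6.5 (b)–(c)] -/
theorem twoCocycle_prime_split_levelOne_of_not_dvd (F : Type) [Field F] [ValuativeRel F]
    [TopologicalSpace F] [IsNonarchimedeanLocalField F] [CharZero F]
    {p : ℕ} (hp : p.Prime) (hpℓ : p ≠ ringChar 𝓀[F]) (hpq : ¬ p ∣ residueFieldCard F - 1)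
    (g : absoluteGaloisGroup F → absoluteGaloisGroup F → AddCircle (1 : ℚ))
    (hg : IsLocallyConstant (Function.uncurry g))
    (hcoc : ∀ σ τ υ, g σ τ + g (σ * τ) υ = g τ υ + g σ (τ * υ)) (hpg : ∀ σ τ, p • g σ τ = 0) :
    ∃ β : absoluteGaloisGroup F → AddCircle (1 : ℚ), IsLocallyConstant β ∧
      (∀ σ τ, g σ τ + β (σ * τ) = β σ + β τ) ∧ ∀ σ, p • β σ = 0 := by
  have h1 : ¬ p ^ (0 + 1) ∣ residueFieldCard F - 1 := by rwa [zero_add, pow_one]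
  have hpsi_lc : IsLocallyConstant (fun _ : absoluteGaloisGroup F => (0 : AddCircle (1 : ℚ))) :=
    IsLocallyConstant.const 0
  have hfull : ∃ σ₀ ∈ absInertia F, (fun _ : absoluteGaloisGroup F => (0 : AddCircle (1 : ℚ))) σ₀ =
      (((1 : ℚ) / (p ^ 0 : ℕ) : ℚ) : AddCircle (1 : ℚ)) :=
    ⟨1, Subgroup.one_mem _, (addCircle_coe_one_div_pow_zero p).symm⟩
  obtain ⟨β, j, hβ_lc, hβ, hpβ⟩ := twoCocycle_prime_split_generator_form F hp hpℓ h1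
    (fun _ => 0) hpsi_lc (fun _ _ => (add_zero _).symm) (fun _ _ => smul_zero _) hfull g hg hcoc hpg
  exact ⟨β, hβ_lc, hβ, fun σ => by rw [hpβ, smul_zero]⟩

end Local

/-! ### Characters of `(ℤ/ℓ)ˣ` of exact order `p^a` -/

section UnitsZMod

/-- For a prime `ℓ` and `p^a ∣ ℓ - 1` there is an additive character `s` of the cyclic group
`(ℤ/ℓ)ˣ` with `p^a • s = 0` taking the value `1/p^a` (on a generator). [folklore] -/
theorem exists_character_units_zmod_of_dvd (ℓ : ℕ) [Fact ℓ.Prime] {p a : ℕ}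
    (hpa : p ^ a ∣ ℓ - 1) :
    ∃ s : (ZMod ℓ)ˣ → AddCircle (1 : ℚ), (∀ x y, s (x * y) = s x + s y) ∧
      (∀ x, p ^ a • s x = 0) ∧ ∃ u, s u = (((1 : ℚ) / (p ^ a : ℕ) : ℚ) : AddCircle (1 : ℚ)) := by
  classical
  haveI : IsCyclic (ZMod ℓ)ˣ := ZMod.isCyclic_units_prime Fact.out
  obtain ⟨c, hc⟩ := IsCyclic.exists_generator (α := (ZMod ℓ)ˣ)
  set t : AddCircle (1 : ℚ) := (((1 : ℚ) / (p ^ a : ℕ) : ℚ) : AddCircle (1 : ℚ)) with ht_def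
  have hpat : p ^ a • t = 0 := by
    rcases Nat.eq_zero_or_pos (p ^ a) with h0 | hpos
    · rw [h0, zero_smul]
    · rw [ht_def, ← AddCircle.coe_nsmul, nsmul_eq_mul,
        mul_one_div_cancel (Nat.cast_ne_zero.2 hpos.ne')]
      exact AddCircle.coe_period 1
  have hord : orderOf c • t = 0 := by
    rw [orderOf_eq_card_of_forall_mem_zpowers hc, Nat.card_eq_fintype_card, ZMod.card_units]
    obtain ⟨d, hd⟩ := hpa
    rw [hd, mul_nsmul, hpat, nsmul_zero]
  obtain ⟨s, hs_add, hsc⟩ := cyclic_exists_character_apply_eq c hc t hord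
  refine ⟨s, hs_add, fun x => ?_, c, hsc⟩
  obtain ⟨i, rfl⟩ : ∃ i : ℤ, c ^ i = x := Subgroup.mem_zpowers_iff.mp (hc x)
  rw [character_apply_zpow hs_add, hsc, smul_comm, hpat, smul_zero]

end UnitsZMod

/-! ### `F = ℚ_ℓ`, `ℓ ≠ p`: the cyclotomic generator -/

section RatPlace

variable (ℓ : ℕ) [Fact ℓ.Prime] (v : HeightOneSpectrum (𝓞 ℚ))

omit [Fact ℓ.Prime] in
/-- `q_{ℚ_v} = ℓ` for the place `v` of `ℚ` above `ℓ`. [folklore] -/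
theorem residueFieldCard_adicCompletion_rat (hv : (Rat.HeightOneSpectrum.primesEquiv v : ℕ) = ℓ) :
    residueFieldCard (v.adicCompletion ℚ) = ℓ := by
  rw [Literature.NumberTheory.Automorphic.residueFieldCard_adicCompletion_eq, ← hv,
    v.residueCard_eq_card_quotient]
  have h : Ideal.span {(Rat.HeightOneSpectrum.natGenerator v : ℤ)} =
      v.asIdeal.map (Rat.IsIntegralClosure.intEquiv (𝓞 ℚ) : 𝓞 ℚ →+* ℤ) :=
    Rat.HeightOneSpectrum.span_natGenerator v
  rw [Nat.card_congr ((Ideal.quotientEquiv _ _ (Rat.IsIntegralClosure.intEquiv (𝓞 ℚ)) h).trans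
    (Int.quotientSpanNatEquivZMod _)).toEquiv, Nat.card_zmod]
  rfl

/-- The residue characteristic of `ℚ_v` is `ℓ` (residue field of the `ValuativeRel` valuation
ring, as in the local files). [folklore] -/
theorem ringChar_residueField_adicCompletion_rat
    (hv : (Rat.HeightOneSpectrum.primesEquiv v : ℕ) = ℓ) :
    ringChar (IsLocalRing.ResidueField
      (ValuativeRel.valuation (v.adicCompletion ℚ)).integer) = ℓ := by
  have hℓ : ℓ.Prime := Fact.out
  obtain ⟨f, hf, hq⟩ := residueFieldCard_eq_pow_ringChar (v.adicCompletion ℚ)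
  rw [residueFieldCard_adicCompletion_rat ℓ v hv] at hq
  exact ((Nat.Prime.pow_eq_iff hℓ).mp hq.symm).1

/-- **The local components at `ℓ ≠ p` are accounted for by Dirichlet characters of conductor `ℓ`**
(Serre §6.5 (b)–(c) at `v = ℓ`, on the Galois side): let `s` be an additive character of
`(ℤ/ℓ)ˣ` with `p^a • s = 0`, taking the value `1/p^a`, where `p^a ∥ ℓ - 1`, and
`ψ = s ∘ χ_ℓ : Γ_{ℚ_ℓ} → ℚ/ℤ` (`χ_ℓ` the mod `ℓ` cyclotomic character; `ψ(I_{ℚ_ℓ}) ∋ 1/p^a`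
since `χ_ℓ(I_{ℚ_ℓ}) = (ℤ/ℓ)ˣ`).  Then every locally constant `p`-torsion `2`-cocycle `g` on
`Γ_{ℚ_ℓ}` is `∂β` with `β` locally constant and `p • β = j • ψ` for an integer `j`.
[cite: SerreDurham1977, §6.5 (b)] [cite: SerreLocalFields1979, Ch. IV §4 Prop. 17] -/
theorem adicCompletion_rat_twoCocycle_prime_split_cyclotomic {p : ℕ} (hp : p.Prime) (hpℓ : p ≠ ℓ)
    (hv : (Rat.HeightOneSpectrum.primesEquiv v : ℕ) = ℓ)
    {a : ℕ} (hpa' : ¬ p ^ (a + 1) ∣ ℓ - 1)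
    (s : (ZMod ℓ)ˣ → AddCircle (1 : ℚ)) (hs : ∀ x y, s (x * y) = s x + s y)
    (hsa : ∀ x, p ^ a • s x = 0)
    (hsfull : ∃ u, s u = (((1 : ℚ) / (p ^ a : ℕ) : ℚ) : AddCircle (1 : ℚ)))
    [NeZero (ℓ : v.adicCompletion ℚ)]
    (g : absoluteGaloisGroup (v.adicCompletion ℚ) → absoluteGaloisGroup (v.adicCompletion ℚ) →
      AddCircle (1 : ℚ))
    (hg : IsLocallyConstant (Function.uncurry g))
    (hcoc : ∀ σ τ υ, g σ τ + g (σ * τ) υ = g τ υ + g σ (τ * υ)) (hpg : ∀ σ τ, p • g σ τ = 0) :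
    ∃ (β : absoluteGaloisGroup (v.adicCompletion ℚ) → AddCircle (1 : ℚ)) (j : ℤ),
      IsLocallyConstant β ∧ (∀ σ τ, g σ τ + β (σ * τ) = β σ + β τ) ∧
      ∀ σ, p • β σ = j • s (modNCyclotomicCharacter (v.adicCompletion ℚ) ℓ σ) := by
  have hℓ : ℓ.Prime := Fact.out
  haveI : CharZero (v.adicCompletion ℚ) := charZero_adicCompletion (K := ℚ) v
  have hq := residueFieldCard_adicCompletion_rat ℓ v hv
  have hchar := ringChar_residueField_adicCompletion_rat ℓ v hv
  -- the character `ψ = s ∘ χ_ℓ`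
  set psi : absoluteGaloisGroup (v.adicCompletion ℚ) → AddCircle (1 : ℚ) :=
    fun σ => s (modNCyclotomicCharacter (v.adicCompletion ℚ) ℓ σ) with hpsi_def
  have hpsi_lc : IsLocallyConstant psi :=
    (isLocallyConstant_modNCyclotomicCharacter (v.adicCompletion ℚ) ℓ).comp s
  have hpsi : ∀ σ τ, psi (σ * τ) = psi σ + psi τ := fun σ τ => by
    simp only [hpsi_def, map_mul, hs]
  have hpsia : ∀ σ ∈ absInertia (v.adicCompletion ℚ), p ^ a • psi σ = 0 := fun σ _ => hsa _
  -- `ψ(I) ∋ 1/p^a`: `χ_ℓ(I_{ℚ_ℓ}) = (ℤ/ℓ)ˣ`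
  have hpsifull : ∃ σ₀ ∈ absInertia (v.adicCompletion ℚ),
      psi σ₀ = (((1 : ℚ) / (p ^ a : ℕ) : ℚ) : AddCircle (1 : ℚ)) := by
    obtain ⟨u, hu⟩ := hsfull
    haveI : NeZero ((ℓ ^ 1 : ℕ) : v.adicCompletion ℚ) := ⟨by rw [pow_one]; exact NeZero.ne _⟩
    haveI : NeZero (ℓ ^ 1) := ⟨by rw [pow_one]; exact hℓ.ne_zero⟩
    obtain ⟨u', hu'⟩ := ZMod.unitsMap_surjective (dvd_of_eq (pow_one ℓ).symm : ℓ ∣ ℓ ^ 1) u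
    obtain ⟨σ₀, hσ₀, hχ⟩ :=
      adicCompletion_rat_exists_mem_absInertia_modNCyclotomicCharacter_eq ℓ v hv Nat.one_pos u'
    refine ⟨σ₀, hσ₀, ?_⟩
    simp only [hpsi_def]
    rw [← unitsMap_modNCyclotomicCharacter_of_dvd (v.adicCompletion ℚ)
      (dvd_of_eq (pow_one ℓ).symm : ℓ ∣ ℓ ^ 1), hχ, hu', hu]
  exact twoCocycle_prime_split_generator_form (v.adicCompletion ℚ) hp (by rw [hchar]; exact hpℓ)
    (by rwa [hq]) psi hpsi_lc hpsi hpsia hpsifull g hg hcoc hpg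

/-- **`H²(ℚ_ℓ, ℤ/p) = 0` at level one for `ℓ ≢ 0, 1 (mod p)`**: every locally constant `p`-torsion
`2`-cocycle on `Γ_{ℚ_ℓ}` is `∂β` with `β` locally constant and `p • β = 0`.
[cite: SerreDurham1977, §6.5 (b)–(c)] -/
theorem adicCompletion_rat_twoCocycle_prime_split_levelOne_of_not_dvd {p : ℕ} (hp : p.Prime)
    (hpℓ : p ≠ ℓ) (hv : (Rat.HeightOneSpectrum.primesEquiv v : ℕ) = ℓ) (hpq : ¬ p ∣ ℓ - 1)
    (g : absoluteGaloisGroup (v.adicCompletion ℚ) → absoluteGaloisGroup (v.adicCompletion ℚ) →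
      AddCircle (1 : ℚ))
    (hg : IsLocallyConstant (Function.uncurry g))
    (hcoc : ∀ σ τ υ, g σ τ + g (σ * τ) υ = g τ υ + g σ (τ * υ)) (hpg : ∀ σ τ, p • g σ τ = 0) :
    ∃ β : absoluteGaloisGroup (v.adicCompletion ℚ) → AddCircle (1 : ℚ), IsLocallyConstant β ∧
      (∀ σ τ, g σ τ + β (σ * τ) = β σ + β τ) ∧ ∀ σ, p • β σ = 0 := by
  haveI : CharZero (v.adicCompletion ℚ) := charZero_adicCompletion (K := ℚ) v
  have hq := residueFieldCard_adicCompletion_rat ℓ v hv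
  have hchar := ringChar_residueField_adicCompletion_rat ℓ v hv
  exact twoCocycle_prime_split_levelOne_of_not_dvd (v.adicCompletion ℚ) hp (by rw [hchar]; exact hpℓ)
    (by rwa [hq]) g hg hcoc hpg

end RatPlace

end Literature.NumberTheory.GaloisRepresentations

end
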